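import Literature.Probability.RandomPlanarGeometry.HexSAWLattice
import Literature.Probability.RandomPlanarGeometry.ConformalRestrictionProofs
import Summits.CriticalPhenomena.SAWScalingLimit.Theorems.SAWDevelopingMapHexTransferQuarterTurnCovariance
import HarnessLib

/-!
# Covariance of the embedded SAW model under lattice symmetries realised by similarities

Helper file of the line `yb-relay` for the crux `HexTransfer` (stmt-CriticalPhenomena-14221): the first
step of every robustness / lattice-symmetry argument about DCS Conjecture 1 (`HexSAWScalingLimit`,
research stub `stub_hexFaceRobustExists`). For the generic embedded layer of `HexSAW.lean`
(`embMeshVertices`, `embMeshGraph`, `embMeshDomain` = union of the largest components, `embDomainGraph`,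
`EmbDomainSAW`, `embWeight`, `embLaw`) and a symmetry datum — a bijection `τ` of the vertices preserving
adjacency of `G` and a plane similarity `S z = c z + w` with `δ' · emb (τ x) = S (δ · emb x)` — the whole
discretisation `Ω ↦ Ω_δ` is transported (`mem_embMeshDomain_symm`, `embDomainGraph_adj_symm`), `τ` is an
isomorphism `Ω_δ ≃g (S Ω)_{δ'}`, and the law `P_{x,δ}` pushed to curves and then along `S` is the law of
the image domain pushed to curves (`map_curve_embLaw_symm`; transport along an arbitrary isomorphism:
`map_curve_embLaw_of_iso`, the embedded analogue of `PinTheShear.map_curve_law_of_iso`). Instance: the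
period translations of the honeycomb lattice (`map_curve_hexSAWLaw_translate`, registered sub-goal): the
critical hexagonal SAW law of `Ω + δ·triEmbed λ` from the translated faces is the translate of that of `Ω`.
Template: `CellGridSaddleSymmetry.lean` (the `δℤ²` cell symmetries). All bookkeeping tagged [folklore].
-/

noncomputable section

open MeasureTheory Filter Topology Set
open Literature.Probability.LatticeModels Literature.Probability.RandomPlanarGeometry
open Literature.Probability.RandomPlanarGeometry.SAW

namespace Summit.CriticalPhenomena.SAWScalingLimit.Cruxes.HexTransfer.YbRelay

/-! ### Similarities: segments and closures -/

/-- The image of a segment under a similarity is the segment between the images (similarities are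
affine on segments: `LatticeSimilarityOfLimit.similarity_lineMap`, inlined here to keep the imports
light). [folklore] -/
theorem image_similarity_segment (c : ℂ) (hc : c ≠ 0) (w x y : ℂ) :
    similarity c hc w '' segment ℝ x y = segment ℝ (similarity c hc w x) (similarity c hc w y) := by
  rw [segment_eq_image_lineMap, segment_eq_image_lineMap, Set.image_image]
  refine Set.image_congr fun t _ => ?_
  simp only [similarity_apply, AffineMap.lineMap_apply_module', Complex.real_smul]
  ring

/-- Closures commute with similarities. [folklore] -/
theorem closure_image_similarity (c : ℂ) (hc : c ≠ 0) (w : ℂ) (Ω : Set ℂ) :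
    closure (similarity c hc w '' Ω) = similarity c hc w '' closure Ω :=
  ((similarity c hc w).image_closure Ω).symm

/-! ### Transport of the discretisation along a symmetry datum -/

section Symm

variable {V : Type*} {G : SimpleGraph V} {emb : V → ℂ} {Ω : Set ℂ} {δ δ' : ℝ}
  {τ : V ≃ V} {c : ℂ} {hc : c ≠ 0} {w : ℂ}
  (hadj : ∀ x y, G.Adj (τ x) (τ y) ↔ G.Adj x y)
  (hemb : ∀ x, (δ' : ℂ) * emb (τ x) = similarity c hc w ((δ : ℂ) * emb x))

include hemb in
/-- Mesh vertices are transported: `τ x` is a mesh vertex of `S Ω` at mesh `δ'` iff `x` is one of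
`Ω` at mesh `δ`. [folklore] -/
theorem mem_embMeshVertices_symm {x : V} :
    τ x ∈ embMeshVertices emb (similarity c hc w '' Ω) δ' ↔ x ∈ embMeshVertices emb Ω δ := by
  rw [mem_embMeshVertices_iff, mem_embMeshVertices_iff, hemb, (similarity c hc w).injective.mem_set_image]

include hemb in
/-- The closed-segment condition is transported. [folklore] -/
theorem segment_symm_subset_closure_iff {x y : V} :
    segment ℝ ((δ' : ℂ) * emb (τ x)) ((δ' : ℂ) * emb (τ y)) ⊆ closure (similarity c hc w '' Ω) ↔
      segment ℝ ((δ : ℂ) * emb x) ((δ : ℂ) * emb y) ⊆ closure Ω := by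
  rw [hemb, hemb, ← image_similarity_segment, closure_image_similarity,
    Set.image_subset_image_iff (similarity c hc w).injective]

include hadj hemb in
/-- The mesh graph is transported. [folklore] -/
theorem embMeshGraph_adj_symm {x y : V} :
    (embMeshGraph G emb (similarity c hc w '' Ω) δ').Adj (τ x) (τ y) ↔ (embMeshGraph G emb Ω δ).Adj x y := by
  rw [embMeshGraph_adj_iff, embMeshGraph_adj_iff, hadj, segment_symm_subset_closure_iff hemb]

include hadj hemb in
/-- The mesh graph of `Ω`, read through the inverse symmetry. [folklore] -/
theorem embMeshGraph_adj_symm' {x y : V} :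
    (embMeshGraph G emb Ω δ).Adj (τ.symm x) (τ.symm y) ↔
      (embMeshGraph G emb (similarity c hc w '' Ω) δ').Adj x y := by
  rw [← embMeshGraph_adj_symm hadj hemb, Equiv.apply_symm_apply, Equiv.apply_symm_apply]

include hemb in
/-- Mesh vertices of `Ω`, read through the inverse symmetry. [folklore] -/
theorem mem_embMeshVertices_symm' {x : V} :
    τ.symm x ∈ embMeshVertices emb Ω δ ↔ x ∈ embMeshVertices emb (similarity c hc w '' Ω) δ' := by
  rw [← mem_embMeshVertices_symm hemb, Equiv.apply_symm_apply]

include hadj hemb in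
/-- Reachability in the mesh vertex graph is transported. [folklore] -/
theorem reachable_symm_iff {x y : V} (hx : x ∈ embMeshVertices emb Ω δ) (hy : y ∈ embMeshVertices emb Ω δ) :
    (embMeshVertexGraph G emb (similarity c hc w '' Ω) δ').Reachable
        ⟨τ x, (mem_embMeshVertices_symm hemb).2 hx⟩ ⟨τ y, (mem_embMeshVertices_symm hemb).2 hy⟩ ↔
      (embMeshVertexGraph G emb Ω δ).Reachable ⟨x, hx⟩ ⟨y, hy⟩ := by
  -- the two induced homomorphisms
  let F : embMeshVertexGraph G emb Ω δ →g embMeshVertexGraph G emb (similarity c hc w '' Ω) δ' :=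
    SimpleGraph.induceHom (G' := embMeshGraph G emb (similarity c hc w '' Ω) δ')
      ⟨τ, fun hab => (embMeshGraph_adj_symm hadj hemb).2 hab⟩
      fun _ hz => (mem_embMeshVertices_symm hemb).2 hz
  let F' : embMeshVertexGraph G emb (similarity c hc w '' Ω) δ' →g embMeshVertexGraph G emb Ω δ :=
    SimpleGraph.induceHom (G := embMeshGraph G emb (similarity c hc w '' Ω) δ')
      (G' := embMeshGraph G emb Ω δ) ⟨τ.symm, fun hab => (embMeshGraph_adj_symm' hadj hemb).2 hab⟩
      fun _ hz => (mem_embMeshVertices_symm' hemb).2 hz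
  constructor
  · intro h
    have h' := h.map F'
    have ex : F' ⟨τ x, (mem_embMeshVertices_symm hemb).2 hx⟩ = ⟨x, hx⟩ :=
      Subtype.ext (τ.symm_apply_apply x)
    have ey : F' ⟨τ y, (mem_embMeshVertices_symm hemb).2 hy⟩ = ⟨y, hy⟩ :=
      Subtype.ext (τ.symm_apply_apply y)
    rwa [ex, ey] at h'
  · intro h
    exact h.map F

omit hadj hemb in
/-- The support of the connected component of a mesh vertex, as a set of vertices, is the set of
mesh vertices reachable from it. [folklore] -/
private theorem mem_image_supp_iff' {Ω : Set ℂ} {δ : ℝ} {x : V} (hx : x ∈ embMeshVertices emb Ω δ)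
    {z : V} :
    z ∈ Subtype.val '' ((embMeshVertexGraph G emb Ω δ).connectedComponentMk ⟨x, hx⟩).supp ↔
      ∃ hz : z ∈ embMeshVertices emb Ω δ, (embMeshVertexGraph G emb Ω δ).Reachable ⟨x, hx⟩ ⟨z, hz⟩ := by
  constructor
  · rintro ⟨⟨z, hz⟩, hmem, rfl⟩
    rw [SimpleGraph.ConnectedComponent.mem_supp_iff, SimpleGraph.ConnectedComponent.eq] at hmem
    exact ⟨hz, hmem.symm⟩
  · rintro ⟨hz, h⟩
    refine ⟨⟨z, hz⟩, ?_, rfl⟩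
    rw [SimpleGraph.ConnectedComponent.mem_supp_iff, SimpleGraph.ConnectedComponent.eq]
    exact h.symm

omit hadj hemb in
/-- The discrete domain in terms of component sizes: a mesh vertex whose component has maximal
size. [folklore] -/
private theorem mem_embMeshDomain_iff_ncard' {Ω : Set ℂ} {δ : ℝ} {x : V} :
    x ∈ embMeshDomain G emb Ω δ ↔ ∃ hx : x ∈ embMeshVertices emb Ω δ,
      ∀ (y : V) (hy : y ∈ embMeshVertices emb Ω δ),
        ((embMeshVertexGraph G emb Ω δ).connectedComponentMk ⟨y, hy⟩).supp.ncard ≤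
          ((embMeshVertexGraph G emb Ω δ).connectedComponentMk ⟨x, hx⟩).supp.ncard := by
  simp only [embMeshDomain, Set.mem_iUnion, Set.mem_image, Subtype.exists, exists_and_right,
    exists_eq_right]
  constructor
  · rintro ⟨C, hC, hx, hxC⟩
    refine ⟨hx, fun y hy => ?_⟩
    have hCx : (embMeshVertexGraph G emb Ω δ).connectedComponentMk ⟨x, hx⟩ = C :=
      (SimpleGraph.ConnectedComponent.mem_supp_iff _ _).1 hxC
    rw [hCx]
    exact hC _
  · rintro ⟨hx, h⟩
    refine ⟨(embMeshVertexGraph G emb Ω δ).connectedComponentMk ⟨x, hx⟩, ?_, hx, rfl⟩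
    intro C'
    induction C' using SimpleGraph.ConnectedComponent.ind with
    | h y => exact h y y.2

include hadj hemb in
/-- Supports of components are transported: the component of `τ x` in `(S Ω)_{δ'}` is the image of
the component of `x`. [folklore] -/
theorem image_supp_symm {x : V} (hx : x ∈ embMeshVertices emb Ω δ) :
    Subtype.val '' ((embMeshVertexGraph G emb (similarity c hc w '' Ω) δ').connectedComponentMk
        ⟨τ x, (mem_embMeshVertices_symm hemb).2 hx⟩).supp =
      τ '' (Subtype.val '' ((embMeshVertexGraph G emb Ω δ).connectedComponentMk ⟨x, hx⟩).supp) := by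
  ext z
  rw [mem_image_supp_iff', Set.mem_image]
  constructor
  · rintro ⟨hz, h⟩
    have hw' : τ.symm z ∈ embMeshVertices emb Ω δ := (mem_embMeshVertices_symm' hemb).2 hz
    refine ⟨τ.symm z, (mem_image_supp_iff' hx).2 ⟨hw', ?_⟩, τ.apply_symm_apply z⟩
    have hz' : τ (τ.symm z) ∈ embMeshVertices emb (similarity c hc w '' Ω) δ' := by
      rwa [Equiv.apply_symm_apply]
    have e : (⟨τ (τ.symm z), hz'⟩ : embMeshVertices emb (similarity c hc w '' Ω) δ') = ⟨z, hz⟩ :=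
      Subtype.ext (τ.apply_symm_apply z)
    have h' : (embMeshVertexGraph G emb (similarity c hc w '' Ω) δ').Reachable
        ⟨τ x, (mem_embMeshVertices_symm hemb).2 hx⟩ ⟨τ (τ.symm z), hz'⟩ := by
      rw [e]; exact h
    exact (reachable_symm_iff hadj hemb hx hw').1 h'
  · rintro ⟨y, hy, rfl⟩
    obtain ⟨hy, h⟩ := (mem_image_supp_iff' hx).1 hy
    exact ⟨(mem_embMeshVertices_symm hemb).2 hy, (reachable_symm_iff hadj hemb hx hy).2 h⟩

include hadj hemb in
/-- Component sizes are invariant under the symmetry. [folklore] -/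
theorem ncard_supp_symm {x : V} (hx : x ∈ embMeshVertices emb Ω δ) :
    ((embMeshVertexGraph G emb (similarity c hc w '' Ω) δ').connectedComponentMk
        ⟨τ x, (mem_embMeshVertices_symm hemb).2 hx⟩).supp.ncard =
      ((embMeshVertexGraph G emb Ω δ).connectedComponentMk ⟨x, hx⟩).supp.ncard := by
  rw [← Set.ncard_image_of_injective _ Subtype.val_injective, image_supp_symm hadj hemb hx,
    Set.ncard_image_of_injective _ τ.injective,
    Set.ncard_image_of_injective _ Subtype.val_injective]

include hadj hemb in
/-- **The discrete domain is transported:** `τ x ∈ (S Ω)_{δ'} ↔ x ∈ Ω_δ` (union of the largest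
connected components of the mesh vertex graph). [folklore] -/
theorem mem_embMeshDomain_symm {x : V} :
    τ x ∈ embMeshDomain G emb (similarity c hc w '' Ω) δ' ↔ x ∈ embMeshDomain G emb Ω δ := by
  rw [mem_embMeshDomain_iff_ncard', mem_embMeshDomain_iff_ncard']
  constructor
  · rintro ⟨hx, h⟩
    refine ⟨(mem_embMeshVertices_symm hemb).1 hx, fun y hy => ?_⟩
    have := h (τ y) ((mem_embMeshVertices_symm hemb).2 hy)
    rwa [ncard_supp_symm hadj hemb hy,
      ncard_supp_symm hadj hemb ((mem_embMeshVertices_symm hemb).1 hx)] at this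
  · rintro ⟨hx, h⟩
    refine ⟨(mem_embMeshVertices_symm hemb).2 hx, fun y hy => ?_⟩
    have := h (τ.symm y) ((mem_embMeshVertices_symm' hemb).2 hy)
    rw [ncard_supp_symm hadj hemb hx]
    rw [← ncard_supp_symm hadj hemb ((mem_embMeshVertices_symm' hemb).2 hy)] at this
    convert this using 4
    exact Subtype.ext (τ.apply_symm_apply y).symm

include hadj hemb in
/-- The `Ω_δ` graph is transported. [folklore] -/
theorem embDomainGraph_adj_symm {x y : V} :
    (embDomainGraph G emb (similarity c hc w '' Ω) δ').Adj (τ x) (τ y) ↔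
      (embDomainGraph G emb Ω δ).Adj x y := by
  rw [embDomainGraph_adj_iff, embDomainGraph_adj_iff, embMeshGraph_adj_symm hadj hemb,
    mem_embMeshDomain_symm hadj hemb, mem_embMeshDomain_symm hadj hemb]

end Symm

/-! ### Transport of the law along an isomorphism of discrete domains -/

section Iso

variable {V V' : Type*} {G : SimpleGraph V} {G' : SimpleGraph V'} {emb : V → ℂ} {emb' : V' → ℂ}

/-- A self-avoiding walk of `Ω_δ` is determined by its underlying walk. [folklore] -/
theorem embDomainSAW_walk_injective {Ω : Set ℂ} {δ : ℝ} {a b : V} :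
    Function.Injective (EmbDomainSAW.walk : EmbDomainSAW G emb Ω δ a b → _) := by
  rintro ⟨p, hp⟩ ⟨q, hq⟩ h
  dsimp only at h
  subst h
  rfl

/-- **Transport of the SAW law at fugacity `x` along an isomorphism of discrete domains.** If
`φ : Ω_δ ≃g Ω'_{δ'}` is a graph isomorphism (possibly between different embedded graphs) realised on
mesh points by a plane map `f` affine on segments (`f (δ emb v) = δ' emb' (φ v)`), then the law of
`Ω_δ` from `a` to `b`, pushed to curves and then along `f`, is the law of `Ω'_{δ'}` from `φ a` to `φ b`
pushed to curves: `γ ↦ φ ∘ γ` is a length-preserving (hence weight-preserving) bijection of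
self-avoiding walks whose curves are the `f`-images (embedded analogue of
`PinTheShear.map_curve_law_of_iso`). [folklore] -/
theorem map_curve_embLaw_of_iso {Ω Ω' : Set ℂ} {δ δ' : ℝ}
    (φ : embDomainGraph G emb Ω δ ≃g embDomainGraph G' emb' Ω' δ') (f : C(ℂ, ℂ))
    (hf : ∀ (x y : ℂ) (c : ℝ), f (AffineMap.lineMap x y c) = AffineMap.lineMap (f x) (f y) c)
    (hφ : ∀ v, f ((δ : ℂ) * emb v) = (δ' : ℂ) * emb' (φ v)) (x : ℝ) {a b : V} {a' b' : V'}
    (ha : φ a = a') (hb : φ b = b') :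
    ((embLaw G emb Ω δ x a b).map (fun γ => γ.curve)).map (CurveClass.map f) =
      (embLaw G' emb' Ω' δ' x a' b').map (fun γ => γ.curve) := by
  subst ha hb
  have hinj : Function.Injective φ.toHom := fun u v h => φ.injective h
  -- the induced map of self-avoiding walks
  set T : EmbDomainSAW G emb Ω δ a b → EmbDomainSAW G' emb' Ω' δ' (φ a) (φ b) :=
    fun γ => ⟨γ.walk.map φ.toHom, γ.isPath.map hinj⟩ with hT
  have hTm : Measurable T := EmbDomainSAW.measurable_of_top _
  have hTbij : Function.Bijective T := by
    refine ⟨fun γ₁ γ₂ h => embDomainSAW_walk_injective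
      (SimpleGraph.Walk.map_injective_of_injective hinj a b (congrArg EmbDomainSAW.walk h)), ?_⟩
    rintro ⟨q, hq⟩
    refine ⟨⟨(q.map φ.symm.toHom).copy (φ.symm_apply_apply a) (φ.symm_apply_apply b), ?_⟩, ?_⟩
    · rw [SimpleGraph.Walk.isPath_copy]
      exact hq.map fun u v h => φ.symm.injective h
    · apply embDomainSAW_walk_injective
      apply SimpleGraph.Walk.support_injective
      change (((q.map φ.symm.toHom).copy _ _).map φ.toHom).support = q.support
      rw [SimpleGraph.Walk.support_map, SimpleGraph.Walk.support_copy,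
        SimpleGraph.Walk.support_map, List.map_map]
      conv_rhs => rw [← List.map_id q.support]
      exact List.map_congr_left fun u _ => φ.apply_symm_apply u
  have hlen : ∀ γ, (T γ).vertexCount = γ.vertexCount := fun γ => by
    simp only [EmbDomainSAW.vertexCount, EmbDomainSAW.length, hT, SimpleGraph.Walk.length_map]
  have hcurve : ∀ γ, (T γ).curve = CurveClass.map f γ.curve := by
    intro γ
    rw [EmbDomainSAW.curve, EmbDomainSAW.curve, CurveClass.map_mk]
    congr 1
    ext t
    exact PinTheShear.toCurve_map_apply φ.toHom (fun v => (δ : ℂ) * emb v)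
      (fun v => (δ' : ℂ) * emb' v) f hf hφ γ.walk t
  have hweight : (embWeight G emb Ω δ x a b).map T = embWeight G' emb' Ω' δ' x (φ a) (φ b) := by
    rw [embWeight, Measure.map_sum hTm.aemeasurable]
    simp only [Measure.map_smul, Measure.map_dirac' hTm]
    rw [embWeight, ← Measure.sum_comp_equiv (Equiv.ofBijective T hTbij)]
    congr 1
    funext γ
    simp only [Function.comp_apply, Equiv.ofBijective_apply, hlen]
  have hlaw : (embLaw G emb Ω δ x a b).map T = embLaw G' emb' Ω' δ' x (φ a) (φ b) := by
    rw [embLaw, Measure.map_smul, hweight, embLaw, ← hweight,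
      Measure.map_apply hTm MeasurableSet.univ, Set.preimage_univ]
  rw [Measure.map_map (CurveClass.measurable_map f) (EmbDomainSAW.measurable_of_top _), ← hlaw,
    Measure.map_map (EmbDomainSAW.measurable_of_top _) hTm]
  congr 1
  funext γ
  exact (hcurve γ).symm

end Iso

/-! ### The law is transported along a symmetry datum -/

section SymmLaw

variable {V : Type*} {G : SimpleGraph V} {emb : V → ℂ} {Ω : Set ℂ} {δ δ' : ℝ}
  {τ : V ≃ V} {c : ℂ} {hc : c ≠ 0} {w : ℂ}

/-- **Covariance of `P_{x,δ}` under a lattice symmetry realised by a similarity**: if `τ` preserves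
adjacency of `G` and `δ' · emb (τ v) = S (δ · emb v)` for the similarity `S z = c z + w`, then the law of
`Ω_δ` from `a` to `b`, pushed to curves and then along `S`, is the law of `(S Ω)_{δ'}` from `τ a` to
`τ b` pushed to curves. [folklore] -/
theorem map_curve_embLaw_symm (hadj : ∀ x y, G.Adj (τ x) (τ y) ↔ G.Adj x y)
    (hemb : ∀ x, (δ' : ℂ) * emb (τ x) = similarity c hc w ((δ : ℂ) * emb x)) (x : ℝ) (a b : V) :
    ((embLaw G emb Ω δ x a b).map (fun γ => γ.curve)).map
        (CurveClass.map (similarity c hc w : C(ℂ, ℂ))) =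
      (embLaw G emb (similarity c hc w '' Ω) δ' x (τ a) (τ b)).map (fun γ => γ.curve) :=
  map_curve_embLaw_of_iso ⟨τ, (embDomainGraph_adj_symm hadj hemb)⟩ _
    (fun x y t => by
      simp only [ContinuousMap.coe_coe, similarity_apply, AffineMap.lineMap_apply_module',
        Complex.real_smul]
      ring)
    (fun v => (hemb v).symm) x rfl rfl

end SymmLaw

/-! ### Instance: period translations of the honeycomb lattice -/

/-- Translating both cells by `λ ∈ ℤ²` preserves adjacency of the honeycomb lattice. [folklore] -/
theorem hexGraph_adj_translate (l : Site 2) (u v : HexVertex) :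
    hexGraph.Adj (u.1 + l, u.2) (v.1 + l, v.2) ↔ hexGraph.Adj u v := by
  obtain ⟨x, i⟩ := u
  obtain ⟨y, j⟩ := v
  simp only [hexGraph_adj_iff_coord, Pi.add_apply]
  omega

/-- The face centres are translated by `triEmbed λ`. [folklore] -/
theorem hexCenter_translate (l : Site 2) (u : HexVertex) :
    hexCenter (u.1 + l, u.2) = hexCenter u + triEmbed l := by
  simp only [hexCenter, triEmbed_add]
  ring

/-- The translation of the faces by `λ ∈ ℤ²`, as a bijection. [folklore] -/
theorem hexTranslate_bijective (l : Site 2) :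
    Function.Bijective fun u : HexVertex => ((u.1 + l, u.2) : HexVertex) :=
  ⟨fun u v h => by
    simp only [Prod.mk.injEq, add_left_inj] at h
    exact Prod.ext h.1 h.2,
   fun v => ⟨(v.1 - l, v.2), by simp⟩⟩

/-- **Translation covariance of the critical hexagonal SAW law** (registered sub-goal): translating
the domain by the period `δ · triEmbed λ` (`λ ∈ ℤ²`) and the endpoint faces by `λ` translates the law of
the drawn curve: `(T_{δ triEmbed λ})_* (curve_* P_{Ω,δ}^{a → b}) = curve_* P_{Ω + δ triEmbed λ, δ}^{a+λ → b+λ}`.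
[folklore] -/
theorem map_curve_hexSAWLaw_translate : ∀ (Ω : Set ℂ) (δ : ℝ) (l : Site 2) (a b : HexVertex), ((hexSAWLaw Ω δ a b).map (fun γ => γ.curve)).map (CurveClass.map (similarity 1 one_ne_zero ((δ : ℂ) * triEmbed l) : C(ℂ, ℂ))) = (hexSAWLaw (similarity 1 one_ne_zero ((δ : ℂ) * triEmbed l) '' Ω) δ (a.1 + l, a.2) (b.1 + l, b.2)).map (fun γ => γ.curve) := by
  intro Ω δ l a b
  have h := map_curve_embLaw_symm (G := hexGraph) (emb := hexCenter) (Ω := Ω) (δ := δ) (δ' := δ)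
    (τ := Equiv.ofBijective _ (hexTranslate_bijective l)) (c := 1) (hc := one_ne_zero)
    (w := (δ : ℂ) * triEmbed l) (fun u v => hexGraph_adj_translate l u v)
    (fun u => by
      change (δ : ℂ) * hexCenter (u.1 + l, u.2) = _
      rw [hexCenter_translate, similarity_apply, one_mul, mul_add])
    hexCriticalFugacity a b
  exact h

/-- **Scaling covariance of the critical hexagonal SAW law**: dilating the domain and the mesh by
`s ≠ 0` dilates the law of the drawn curve. [folklore] -/
theorem map_curve_hexSAWLaw_scale (Ω : Set ℂ) (δ s : ℝ) (hs : s ≠ 0) (a b : HexVertex) :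
    ((hexSAWLaw Ω δ a b).map (fun γ => γ.curve)).map
        (CurveClass.map (similarity (s : ℂ) (Complex.ofReal_ne_zero.2 hs) 0 : C(ℂ, ℂ))) =
      (hexSAWLaw (similarity (s : ℂ) (Complex.ofReal_ne_zero.2 hs) 0 '' Ω) (s * δ) a b).map
        (fun γ => γ.curve) := by
  have h := map_curve_embLaw_symm (G := hexGraph) (emb := hexCenter) (Ω := Ω) (δ := δ) (δ' := s * δ)
    (τ := Equiv.refl HexVertex) (c := (s : ℂ)) (hc := Complex.ofReal_ne_zero.2 hs) (w := 0)
    (fun u v => Iff.rfl)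
    (fun u => by
      change ((s * δ : ℝ) : ℂ) * hexCenter u = _
      rw [similarity_apply, add_zero, Complex.ofReal_mul, mul_assoc])
    hexCriticalFugacity a b
  exact h

end Summit.CriticalPhenomena.SAWScalingLimit.Cruxes.HexTransfer.YbRelay

end
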